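import Summits.BirchSwinnertonDyer.Rank1Residual.Additive.CensusKurregRecordRows
import HarnessLib

/-!
# KURREG joint table: the CONSISTENCY column is kernel-backed — the Q6 first-unit-index record and
# the valuation record are UNIQUE per row, a record at `n₀ ≥ 2` forces `v₁ ≥ 1`, and at analytic
# rank `1` a record forces `n₀ ≥ 1`, `= 1` exactly when `v₁ = 0`
# (cell `b2b-bsdres`, census cell, seat `b2b-bsdres-census-ctyper1` = conjecture-typer 1 /
# KURREG joint-table owner, gen 5; sequel of `CensusKurregRecordRows.lean`)

HONEST FRAMING (cell `b2b-bsdres`, run/shared/lean/b2b/bsd-rank1-residual/, verbatim in every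
file): the goal of the cell is to DELETE the COMBINATION-SHAPED residual classes of the
Birch–Swinnerton-Dyer formula for ALL analytic-rank `≤ 1` elliptic curves over `ℚ` — "full BSD
formula for every rank `≤ 1` curve in class `C`" assembled STRICTLY from published theorems — so
that the rank-`≤ 1` remainder becomes exactly the CONSTRUCTION-SHAPED classes, which are TYPED
(missing-input `Prop`s), NOT attempted. This is not "finishing BSD". Census cell: research
instrumentation; census / instrument output (Q6 records, valuation records) = EVIDENCE / per-pair
CERTIFICATE-EVIDENCE for the kernel cell, never a Literature fact; nothing booked; no mark / label
moved. Theorems only (no `def`, no named fact).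

## What and why

The KURREG assembler (`HOME/b2b-bsdres-census-ctyper1/kurreg/kurreg_merge.py` v0.3, ASSEMBLY-SPEC v0.3
§3-n₀; register `cells/n1011/PREDICTIONS-KURREG.md` §9 A5) types a row `INCONSISTENT(…)` when its
certificate columns contradict each other (`c1 = 1` with `n0 ≠ 1` or `v1 ≠ 0`; `n0 = 1` with `v1 ≠ 0`;
`v1 = 0` with `n0 ≠ 1`; `n0 ≥ 2` with `v1 < 1`) and `ENGINE-DISAGREE` when two engines report different
`n0` or `v1`. These are KERNEL facts about the record predicates, not conventions. On a row of
X4♯(G-ord) ∩ `I₀*` a datum exists (`ClassX4Gord.exists_goodOrd_pStar_twist_model` + `hmodD` + the period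
ratio of the parity), resp. on X4(M) (`ClassX4M.exists_mult_pStar_twist_model`, `a_p(f♭) = ±1`), hence:
(i) the valuation record is single-valued (`ClassX4Gord.gordCoeffValAt_unique`,
`ClassX4M.multCoeffValAt_unique`); (ii) the first-unit-index record is single-valued
(`ClassX4Gord.firstUnitIndexRecord_unique`, `ClassX4M.multFirstUnitIndexRecord_unique`); (iii) a record
at `n₀ ≥ 2` and a valuation record at index `1` force `1 ≤ v₁` (`…one_le_of_…FirstUnitIndexRecord_of_…CoeffValAt_one`);
(iv) at `L(E,1) = 0` (analytic rank `1`) a record has `1 ≤ n₀` — the constant term of the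
Néron-normalised branch vanishes (additive-p2's `constantCoeff_branch_eq_zero_of_entireLFunction_one_eq_zero`,
n1011-p07's `constantCoeff_multBranch_eq_zero_…`; Pal 2012 `hPal` at `p ≡ 1 (mod 4)`) — and with `v₁ = 0`
exactly `n₀ = 1` (`ClassX4Gord.firstUnitIndexRecord_eq_one_of_gordCoeffValAt_one_zero`,
`ClassX4M.multFirstUnitIndexRecord_eq_one_of_multCoeffValAt_one_zero`): the index-1 certificate row and the
index-`n₀` record row coincide exactly when `v1 = 0`. Pointwise tools (§0):
`CensusQ6.norm_coeff_lt_one_of_firstUnitIndexRecord` / `CensusQ6.norm_coeff_of_multFirstUnitIndexRecord` —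
the parity-split records read in the parity-uniform currency of `BranchUnitCoeffAt` / `GordCoeffValAt` /
`MultCoeffValAt` (companions of `CensusQ6.branchUnitCoeffAt_of_firstUnitIndexRecord`). Per pair;
EVIDENCE-conditional in the record binders; nothing about any curve is asserted; nothing booked.

References: [MazurTateTeitelbaum1986Invent] §I.10, §I.13 (the branch series of the records; nothing
asserted); [Pal2012] Thm. 3.2 (`hPal`, the `p ≡ 1 (mod 4)` constant term). Cell files:
cells/n1011/PREDICTIONS-KURREG.md §9 A5; HOME/b2b-bsdres-census-ctyper1/kurreg/ASSEMBLY-SPEC.md §3-n₀.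
-/

set_option autoImplicit false

noncomputable section

open scoped Classical MatrixGroups ModularForm NumberField

open CongruenceSubgroup WeierstrassCurve NumberField Literature.NumberTheory.EllipticCurves
  Literature.NumberTheory.EllipticCurves.ModularForms
  Literature.NumberTheory.EllipticCurves.Rank1Residual
  Literature.NumberTheory.EllipticCurves.Rank1Residual.Typed
  Literature.NumberTheory.EllipticCurves.Delbourgo2002
  Literature.NumberTheory.GaloisRepresentations
  Summit.BirchSwinnertonDyer.Rank1Residual.AdditivePotMult
  IsDedekindDomain

namespace Summit.BirchSwinnertonDyer.Rank1Residual.Additive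

/-! ### §0 Pointwise tools -/

section Pointwise

variable {W : WeierstrassCurve ℚ} {p : ℕ} [hp : Fact p.Prime]

omit hp in
/-- `p^{−v} = p^{−v'}` in `ℝ` forces `v = v'` (`p > 1`). [folklore] -/
private theorem eq_of_zpow_neg_eq [Fact p.Prime] {v v' : ℤ}
    (h : (p : ℝ) ^ (-v) = (p : ℝ) ^ (-v')) : v = v' := by
  have hp1 : (1 : ℝ) < p := by exact_mod_cast (Fact.out : p.Prime).one_lt
  have := zpow_right_injective₀ (lt_trans zero_lt_one hp1) hp1.ne' h
  omega

omit hp in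
/-- `p^{−v} < 1` in `ℝ` forces `1 ≤ v`. [folklore] -/
private theorem one_le_of_zpow_neg_lt_one [Fact p.Prime] {v : ℤ}
    (h : (p : ℝ) ^ (-v) < 1) : 1 ≤ v := by
  by_contra hv
  have hp1 : (1 : ℝ) ≤ p := by exact_mod_cast (Fact.out : p.Prime).one_lt.le
  have : (1 : ℝ) ≤ (p : ℝ) ^ (-v) := one_le_zpow₀ hp1 (by omega)
  linarith

/-- **The parity-split (G-ord) record at `n₀`: every coefficient BELOW `n₀` is a non-unit**, read in
the parity-uniform currency (twist by `p*`, period ratio of the parity of `(p−1)/2`) of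
`BranchUnitCoeffAt` / `CensusQ6.GordCoeffValAt`. [cite: MazurTateTeitelbaum1986Invent, §I.13 (the record; nothing asserted)] -/
theorem CensusQ6.norm_coeff_lt_one_of_firstUnitIndexRecord (hp2 : p ≠ 2) {n₀ : ℕ}
    (hrec : (p % 4 = 1 → CensusQ6.GordFirstUnitIndexAt W p n₀) ∧
      (p % 4 = 3 → CensusQ6.GordOddFirstUnitIndexAt W p n₀)) {m : ℕ} (hm : m < n₀)
    (V : WeierstrassCurve ℚ) [V.IsElliptic] [V.IsGloballyMinimal] (C : VariableChange ℚ)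
    (hC : C • V.quadraticTwist ((-1 : ℚ) ^ (p / 2) * p) = W) (hord : IsOrdinaryAt V p)
    {N : ℕ} [NeZero N] (f : CuspForm (Gamma0 N) 2) (hf : IsNewformOf V f) (ϖ : ℚ)
    (hϖ : if Even (p / 2) then (ϖ : ℝ) * V.realPeriodRat = plusPeriod f
      else (ϖ : ℝ) * V.imaginaryPeriodRat = minusPeriod f) :
    ‖PowerSeries.coeff m (PowerSeries.C (ϖ : ℚ_[p]) *
        (if Even (p / 2) then padicLFunctionBranch f ((unitRoot V p : ℤ_[p]) : ℚ_[p]) (p / 2)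
          else padicLFunctionMinusBranch f ((unitRoot V p : ℤ_[p]) : ℚ_[p]) (p / 2)))‖ < 1 := by
  rcases hp.out.eq_two_or_odd with h2 | hodd
  · exact absurd h2 hp2
  · by_cases h1 : p % 4 = 1
    · have heven : Even (p / 2) := ⟨p / 4, by omega⟩
      have hC' : C • V.quadraticTwist (p : ℚ) = W := by
        rw [pStar_eq_self_of_mod_four_eq_one h1] at hC; exact hC
      rw [if_pos heven] at hϖ ⊢
      exact ((hrec.1 h1) V C hord hC' f hf ϖ hϖ).1 m hm
    · have h3 : p % 4 = 3 := by omega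
      have hodd' : ¬ Even (p / 2) := by rw [Nat.not_even_iff_odd]; exact ⟨p / 4, by omega⟩
      have hC' : C • V.quadraticTwist (-(p : ℚ)) = W := by
        rw [pStar_eq_neg_of_mod_four_eq_three h3] at hC; exact hC
      rw [if_neg hodd'] at hϖ ⊢
      exact ((hrec.2 h3) V C hord hC' f hf ϖ hϖ).1 m hm

/-- **The parity-split (M) record at `n₀`: the coefficient AT `n₀` is a unit and every coefficient BELOW
`n₀` is a non-unit**, in the parity-uniform currency of `CensusQ6.MultCoeffValAt` (twist by `p*`,
`a_p(f♭) = ap`, period ratio of the parity). [cite: MazurTateTeitelbaum1986Invent, §I.10, §I.13 (the record; nothing asserted)] -/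
theorem CensusQ6.norm_coeff_of_multFirstUnitIndexRecord (hp2 : p ≠ 2) {n₀ : ℕ}
    (hrec : (p % 4 = 1 → CensusQ6.MultFirstUnitIndexAt W p n₀) ∧
      (p % 4 = 3 → CensusQ6.MultOddFirstUnitIndexAt W p n₀))
    (V : WeierstrassCurve ℚ) [V.IsElliptic] [V.IsGloballyMinimal] (C : VariableChange ℚ)
    (hV : Mult V p) (hC : C • V.quadraticTwist ((-1 : ℚ) ^ (p / 2) * p) = W)
    {N : ℕ} [NeZero N] (f : CuspForm (Gamma0 N) 2) (hf : IsNewformOf V f) (ap : ℤ)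
    (hap : cuspCoeff f p = ap) (ϖ : ℚ)
    (hϖ : if Even (p / 2) then (ϖ : ℝ) * V.realPeriodRat = plusPeriod f
      else (ϖ : ℝ) * V.imaginaryPeriodRat = minusPeriod f) :
    (∀ m < n₀, ‖PowerSeries.coeff m (PowerSeries.C (ϖ : ℚ_[p]) *
        (if Even (p / 2) then padicLFunctionPlusBranchMult f (ap : ℚ_[p]) (p / 2)
          else padicLFunctionMinusBranchMult f (ap : ℚ_[p]) (p / 2)))‖ < 1) ∧
      ‖PowerSeries.coeff n₀ (PowerSeries.C (ϖ : ℚ_[p]) *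
        (if Even (p / 2) then padicLFunctionPlusBranchMult f (ap : ℚ_[p]) (p / 2)
          else padicLFunctionMinusBranchMult f (ap : ℚ_[p]) (p / 2)))‖ = 1 := by
  rcases hp.out.eq_two_or_odd with h2 | hodd
  · exact absurd h2 hp2
  · by_cases h1 : p % 4 = 1
    · have heven : Even (p / 2) := ⟨p / 4, by omega⟩
      have hC' : C • V.quadraticTwist (p : ℚ) = W := by
        rw [pStar_eq_self_of_mod_four_eq_one h1] at hC; exact hC
      rw [if_pos heven] at hϖ
      simp only [if_pos heven]
      exact (hrec.1 h1) V C hV hC' f hf ap hap ϖ hϖ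
    · have h3 : p % 4 = 3 := by omega
      have hodd' : ¬ Even (p / 2) := by rw [Nat.not_even_iff_odd]; exact ⟨p / 4, by omega⟩
      have hC' : C • V.quadraticTwist (-(p : ℚ)) = W := by
        rw [pStar_eq_neg_of_mod_four_eq_three h3] at hC; exact hC
      rw [if_neg hodd'] at hϖ
      simp only [if_neg hodd']
      exact (hrec.2 h3) V C hV hC' f hf ap hap ϖ hϖ

end Pointwise

/-! ### §1 (G-ord): uniqueness of the records, `n₀ ≥ 2 ⇒ v₁ ≥ 1`, rank one `⇒ n₀ ≥ 1`, `v₁ = 0 ⇔ n₀ = 1` -/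

section Gord

variable {W : WeierstrassCurve ℚ} [W.IsElliptic] [W.IsGloballyMinimal] {p : ℕ} [hp : Fact p.Prime]

/-- A good-ordinary `p*`-twist datum of a X4♯(G-ord) ∩ `I₀*` pair together with a newform and the period
ratio of the parity of `(p−1)/2` (the data every (G-ord) record quantifies over) EXISTS. [folklore] -/
private theorem ClassX4Gord.exists_recordDatum (hmodD : nonempty_modularParametrizationData)
    (hX : ClassX4Gord W p) (he : semistabilityIndex W p = 2) :
    ∃ (V : WeierstrassCurve ℚ) (_ : V.IsElliptic) (_ : V.IsGloballyMinimal) (C : VariableChange ℚ)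
      (_ : C • V.quadraticTwist ((-1 : ℚ) ^ (p / 2) * p) = W) (_ : IsOrdinaryAt V p) (N : ℕ)
      (_ : NeZero N) (f : CuspForm (Gamma0 N) 2) (_ : IsNewformOf V f) (ϖ : ℚ),
      (if Even (p / 2) then (ϖ : ℝ) * V.realPeriodRat = plusPeriod f
        else (ϖ : ℝ) * V.imaginaryPeriodRat = minusPeriod f) := by
  obtain ⟨V, iV, iVm, C, hV, hC⟩ := hX.exists_goodOrd_pStar_twist_model W p he
  haveI : NeZero (V.conductorNorm ℤ) := ⟨(V.conductorNorm_pos_holds).ne'⟩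
  obtain ⟨Dm⟩ := hmodD V
  obtain ⟨ϖ, hϖ⟩ := exists_periodRatio_parity (p := p) V Dm
  exact ⟨V, iV, iVm, C, hC, isOrdinaryAt_of_goodOrd_or_mult_of_model_twist W V (pStar_ne_zero p) ⟨C, hC⟩
    (padicValRat_j_nonneg_of_typeGOrd W p hX.typeGOrd) (Or.inl hV), _, inferInstance, Dm.f,
    Dm.isNewformOf, ϖ, hϖ⟩

/-- **The valuation record is single-valued on X4♯(G-ord) ∩ `I₀*`**: `GordCoeffValAt W p k v` and
`GordCoeffValAt W p k v'` force `v = v'` (a datum exists: the good-ordinary `p*`-twist model, a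
parametrisation datum, the period ratio of the parity). Two engines reporting different `v_k` cannot
both certify the record (the assembler's `ENGINE-DISAGREE`). [cite: MazurTateTeitelbaum1986Invent, §I.13 (the record; nothing asserted)] -/
theorem ClassX4Gord.gordCoeffValAt_unique (hmodD : nonempty_modularParametrizationData)
    (hX : ClassX4Gord W p) (he : semistabilityIndex W p = 2) {k : ℕ} {v v' : ℤ}
    (h : CensusQ6.GordCoeffValAt W p k v) (h' : CensusQ6.GordCoeffValAt W p k v') : v = v' := by
  obtain ⟨V, iV, iVm, C, hC, hord, N, iN, f, hf, ϖ, hϖ⟩ := hX.exists_recordDatum hmodD he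
  exact eq_of_zpow_neg_eq
    ((h V C hC hord f hf ϖ hϖ).symm.trans (h' V C hC hord f hf ϖ hϖ))

/-- **The first-unit-index record is single-valued on X4♯(G-ord) ∩ `I₀*`** (odd `p`): the parity-split
records at `n₀` and at `n₀'` force `n₀ = n₀'` (below the first unit index every coefficient is a
non-unit; at it, a unit). [cite: MazurTateTeitelbaum1986Invent, §I.13 (the record; nothing asserted)] -/
theorem ClassX4Gord.firstUnitIndexRecord_unique (hmodD : nonempty_modularParametrizationData)
    (hX : ClassX4Gord W p) (hp2 : p ≠ 2) (he : semistabilityIndex W p = 2) {n₀ n₀' : ℕ}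
    (hrec : (p % 4 = 1 → CensusQ6.GordFirstUnitIndexAt W p n₀) ∧
      (p % 4 = 3 → CensusQ6.GordOddFirstUnitIndexAt W p n₀))
    (hrec' : (p % 4 = 1 → CensusQ6.GordFirstUnitIndexAt W p n₀') ∧
      (p % 4 = 3 → CensusQ6.GordOddFirstUnitIndexAt W p n₀')) : n₀ = n₀' := by
  obtain ⟨V, iV, iVm, C, hC, hord, N, iN, f, hf, ϖ, hϖ⟩ := hX.exists_recordDatum hmodD he
  by_contra hne
  rcases Nat.lt_or_gt_of_ne hne with hlt | hgt
  · have h1 := CensusQ6.branchUnitCoeffAt_of_firstUnitIndexRecord hp2 hrec V C hC hord f hf ϖ hϖ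
    have h2 := CensusQ6.norm_coeff_lt_one_of_firstUnitIndexRecord hp2 hrec' hlt V C hC hord f hf ϖ hϖ
    linarith
  · have h1 := CensusQ6.branchUnitCoeffAt_of_firstUnitIndexRecord hp2 hrec' V C hC hord f hf ϖ hϖ
    have h2 := CensusQ6.norm_coeff_lt_one_of_firstUnitIndexRecord hp2 hrec hgt V C hC hord f hf ϖ hϖ
    linarith

/-- **Column consistency `n0 ≥ 2 ⇒ v1 ≥ 1` on X4♯(G-ord) ∩ `I₀*`**: a record at `n₀ ≥ 2` (so `c₁(ϖB)` is
a non-unit) and a valuation record `GordCoeffValAt W p 1 v₁` force `1 ≤ v₁`.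
[cite: MazurTateTeitelbaum1986Invent, §I.13 (the record; nothing asserted)] -/
theorem ClassX4Gord.one_le_of_firstUnitIndexRecord_of_gordCoeffValAt_one
    (hmodD : nonempty_modularParametrizationData)
    (hX : ClassX4Gord W p) (hp2 : p ≠ 2) (he : semistabilityIndex W p = 2) {n₀ : ℕ} (hn : 2 ≤ n₀)
    (hrec : (p % 4 = 1 → CensusQ6.GordFirstUnitIndexAt W p n₀) ∧
      (p % 4 = 3 → CensusQ6.GordOddFirstUnitIndexAt W p n₀))
    {v₁ : ℤ} (hv1 : CensusQ6.GordCoeffValAt W p 1 v₁) : 1 ≤ v₁ := by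
  obtain ⟨V, iV, iVm, C, hC, hord, N, iN, f, hf, ϖ, hϖ⟩ := hX.exists_recordDatum hmodD he
  have hlt := CensusQ6.norm_coeff_lt_one_of_firstUnitIndexRecord hp2 hrec
    (show 1 < n₀ by omega) V C hC hord f hf ϖ hϖ
  rw [hv1 V C hC hord f hf ϖ hϖ] at hlt
  exact one_le_of_zpow_neg_lt_one hlt

/-- **At `L(E,1) = 0` (analytic rank `1`) a record has `n₀ ≥ 1`** on X4♯(G-ord) ∩ `I₀*`: the constant
term of the Néron-normalised branch VANISHES (additive-p2's
`constantCoeff_branch_eq_zero_of_entireLFunction_one_eq_zero` — interpolation + Birch, with Pal 2012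
Thm. 3.2 `hPal` at `p ≡ 1 (mod 4)`), so it is not a unit. [cite: MazurTateTeitelbaum1986Invent, §I.13–I.14]
[cite: Pal2012, Thm. 3.2] -/
theorem ClassX4Gord.one_le_firstUnitIndexRecord_of_entireLFunction_one_eq_zero
    (hPal : Pal2012.thm32_sqrt_mul_realPeriodRat_twist_eq_of_prime_one_mod_four)
    (hmod : hasEntireLFunction_rat) (hmodD : nonempty_modularParametrizationData)
    (hX : ClassX4Gord W p) (hp2 : p ≠ 2) (he : semistabilityIndex W p = 2)
    (hL : W.entireLFunction 1 = 0) {n₀ : ℕ}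
    (hrec : (p % 4 = 1 → CensusQ6.GordFirstUnitIndexAt W p n₀) ∧
      (p % 4 = 3 → CensusQ6.GordOddFirstUnitIndexAt W p n₀)) : 1 ≤ n₀ := by
  obtain ⟨V, iV, iVm, C, hC, hord, N, iN, f, hf, ϖ, hϖ⟩ := hX.exists_recordDatum hmodD he
  by_contra h0
  obtain rfl : n₀ = 0 := by omega
  have h1 := CensusQ6.branchUnitCoeffAt_of_firstUnitIndexRecord hp2 hrec V C hC hord f hf ϖ hϖ
  have hz := constantCoeff_branch_eq_zero_of_entireLFunction_one_eq_zero hPal hmod hp2 hX.addv.2 hL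
    V C hC hord hf ϖ hϖ
  rw [PowerSeries.coeff_zero_eq_constantCoeff_apply, hz, norm_zero] at h1
  exact zero_ne_one h1

/-- **`v1 = 0 ⇔ n0 = 1` at analytic rank `1`** on X4♯(G-ord) ∩ `I₀*`: a record at `n₀`, the valuation
record `GordCoeffValAt W p 1 0` (a unit linear coefficient) and `L(E,1) = 0` force `n₀ = 1` — the
index-1 certificate row and the index-`n₀` record row coincide exactly when `v₁ = 0` (the assembler's
`INCONSISTENT(c1 …)` flags). [cite: MazurTateTeitelbaum1986Invent, §I.13–I.14] [cite: Pal2012, Thm. 3.2] -/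
theorem ClassX4Gord.firstUnitIndexRecord_eq_one_of_gordCoeffValAt_one_zero
    (hPal : Pal2012.thm32_sqrt_mul_realPeriodRat_twist_eq_of_prime_one_mod_four)
    (hmod : hasEntireLFunction_rat) (hmodD : nonempty_modularParametrizationData)
    (hX : ClassX4Gord W p) (hp2 : p ≠ 2) (he : semistabilityIndex W p = 2)
    (hL : W.entireLFunction 1 = 0) {n₀ : ℕ}
    (hrec : (p % 4 = 1 → CensusQ6.GordFirstUnitIndexAt W p n₀) ∧
      (p % 4 = 3 → CensusQ6.GordOddFirstUnitIndexAt W p n₀))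
    (hv1 : CensusQ6.GordCoeffValAt W p 1 0) : n₀ = 1 := by
  have h1 := hX.one_le_firstUnitIndexRecord_of_entireLFunction_one_eq_zero hPal hmod hmodD hp2 he hL hrec
  by_contra hne
  have h2 := hX.one_le_of_firstUnitIndexRecord_of_gordCoeffValAt_one hmodD hp2 he (show 2 ≤ n₀ by omega)
    hrec hv1
  omega

end Gord

end Summit.BirchSwinnertonDyer.Rank1Residual.Additive

/-! ### §2 (M): uniqueness of the records, `n₀ ≥ 2 ⇒ v₁ ≥ 1`, rank one `⇒ n₀ ≥ 1`, `v₁ = 0 ⇔ n₀ = 1` -/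

namespace Summit.BirchSwinnertonDyer.Rank1Residual.AdditivePotMult

open CongruenceSubgroup WeierstrassCurve NumberField Literature.NumberTheory.EllipticCurves
  Literature.NumberTheory.EllipticCurves.ModularForms
  Literature.NumberTheory.EllipticCurves.Rank1Residual
  Literature.NumberTheory.EllipticCurves.Rank1Residual.Typed
  Literature.NumberTheory.EllipticCurves.Delbourgo2002
  Literature.NumberTheory.GaloisRepresentations
  Summit.BirchSwinnertonDyer.Rank1Residual.Additive
  IsDedekindDomain

section Mult

variable {W : WeierstrassCurve ℚ} [W.IsElliptic] {p : ℕ} [hp : Fact p.Prime]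

/-- A multiplicative `p*`-twist datum of a X4(M) pair together with a newform, `a_p(f) = ±1` and the
period ratio of the parity (the data every (M) record quantifies over) EXISTS. [folklore] -/
private theorem ClassX4M.exists_recordDatum (hmodD : nonempty_modularParametrizationData)
    (hX : ClassX4M W p) :
    ∃ (V : WeierstrassCurve ℚ) (_ : V.IsElliptic) (_ : V.IsGloballyMinimal) (C : VariableChange ℚ)
      (_ : Mult V p) (_ : C • V.quadraticTwist ((-1 : ℚ) ^ (p / 2) * p) = W) (N : ℕ) (_ : NeZero N)
      (f : CuspForm (Gamma0 N) 2) (_ : IsNewformOf V f) (ap : ℤ) (_ : cuspCoeff f p = ap) (ϖ : ℚ),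
      (if Even (p / 2) then (ϖ : ℝ) * V.realPeriodRat = plusPeriod f
        else (ϖ : ℝ) * V.imaginaryPeriodRat = minusPeriod f) := by
  obtain ⟨V, iV, iVm, C, hV, hC⟩ := hX.exists_mult_pStar_twist_model
  haveI : NeZero (V.conductorNorm ℤ) := ⟨(V.conductorNorm_pos_holds).ne'⟩
  obtain ⟨Dm⟩ := hmodD V
  obtain ⟨ϖ, hϖ⟩ := exists_periodRatio_parity (p := p) V Dm
  obtain ⟨ap, hap⟩ : ∃ ap : ℤ, cuspCoeff Dm.f p = ap := by
    by_cases hs : V.HasSplitMultiplicativeReductionAtPrime p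
    · exact ⟨1, by exact_mod_cast (Dm.isNewformOf.cuspCoeff_eq_one_and_sq_of_split hs).1⟩
    · exact ⟨-1, by exact_mod_cast (Dm.isNewformOf.cuspCoeff_eq_neg_one_and_dvd_of_nonsplit hV hs).1⟩
  exact ⟨V, iV, iVm, C, hV, hC, _, inferInstance, Dm.f, Dm.isNewformOf, ap, hap, ϖ, hϖ⟩

/-- **The (M) valuation record is single-valued on X4(M)**: `MultCoeffValAt W p k v` and
`MultCoeffValAt W p k v'` force `v = v'` (a datum exists: the multiplicative `p*`-twist model, a
parametrisation datum, `a_p = ±1` by the reduction sign, the period ratio of the parity).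
[cite: MazurTateTeitelbaum1986Invent, §I.10, §I.13 (the record; nothing asserted)] -/
theorem ClassX4M.multCoeffValAt_unique (hmodD : nonempty_modularParametrizationData)
    (hX : ClassX4M W p) {k : ℕ} {v v' : ℤ}
    (h : CensusQ6.MultCoeffValAt W p k v) (h' : CensusQ6.MultCoeffValAt W p k v') : v = v' := by
  obtain ⟨V, iV, iVm, C, hV, hC, N, iN, f, hf, ap, hap, ϖ, hϖ⟩ := hX.exists_recordDatum hmodD
  exact eq_of_zpow_neg_eq
    ((h V C hV hC f hf ap hap ϖ hϖ).symm.trans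
      (h' V C hV hC f hf ap hap ϖ hϖ))

/-- **The (M) first-unit-index record is single-valued on X4(M)** (odd `p`).
[cite: MazurTateTeitelbaum1986Invent, §I.10, §I.13 (the record; nothing asserted)] -/
theorem ClassX4M.multFirstUnitIndexRecord_unique (hmodD : nonempty_modularParametrizationData)
    (hX : ClassX4M W p) {n₀ n₀' : ℕ}
    (hrec : (p % 4 = 1 → CensusQ6.MultFirstUnitIndexAt W p n₀) ∧
      (p % 4 = 3 → CensusQ6.MultOddFirstUnitIndexAt W p n₀))
    (hrec' : (p % 4 = 1 → CensusQ6.MultFirstUnitIndexAt W p n₀') ∧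
      (p % 4 = 3 → CensusQ6.MultOddFirstUnitIndexAt W p n₀')) : n₀ = n₀' := by
  have hp2 : p ≠ 2 := hX.p_ne_two
  obtain ⟨V, iV, iVm, C, hV, hC, N, iN, f, hf, ap, hap, ϖ, hϖ⟩ := hX.exists_recordDatum hmodD
  have r := CensusQ6.norm_coeff_of_multFirstUnitIndexRecord hp2 hrec V C hV hC f hf ap
    hap ϖ hϖ
  have r' := CensusQ6.norm_coeff_of_multFirstUnitIndexRecord hp2 hrec' V C hV hC f hf ap
    hap ϖ hϖ
  by_contra hne
  rcases Nat.lt_or_gt_of_ne hne with hlt | hgt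
  · have h1 := r.2
    have h2 := r'.1 n₀ hlt
    linarith
  · have h1 := r'.2
    have h2 := r.1 n₀' hgt
    linarith

/-- **Column consistency `n0 ≥ 2 ⇒ v1 ≥ 1` on X4(M)**: a (M) record at `n₀ ≥ 2` and a valuation record
`MultCoeffValAt W p 1 v₁` force `1 ≤ v₁`. [cite: MazurTateTeitelbaum1986Invent, §I.10, §I.13 (the record; nothing asserted)] -/
theorem ClassX4M.one_le_of_multFirstUnitIndexRecord_of_multCoeffValAt_one
    (hmodD : nonempty_modularParametrizationData) (hX : ClassX4M W p) {n₀ : ℕ} (hn : 2 ≤ n₀)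
    (hrec : (p % 4 = 1 → CensusQ6.MultFirstUnitIndexAt W p n₀) ∧
      (p % 4 = 3 → CensusQ6.MultOddFirstUnitIndexAt W p n₀))
    {v₁ : ℤ} (hv1 : CensusQ6.MultCoeffValAt W p 1 v₁) : 1 ≤ v₁ := by
  have hp2 : p ≠ 2 := hX.p_ne_two
  obtain ⟨V, iV, iVm, C, hV, hC, N, iN, f, hf, ap, hap, ϖ, hϖ⟩ := hX.exists_recordDatum hmodD
  have hlt := (CensusQ6.norm_coeff_of_multFirstUnitIndexRecord hp2 hrec V C hV hC f hf
    ap hap ϖ hϖ).1 1 (by omega)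
  rw [hv1 V C hV hC f hf ap hap ϖ hϖ] at hlt
  exact one_le_of_zpow_neg_lt_one hlt

end Mult

section MultRankOne

variable {W : WeierstrassCurve ℚ} [W.IsElliptic] [W.IsGloballyMinimal] {p : ℕ} [hp : Fact p.Prime]

/-- **At `L(E,1) = 0` (analytic rank `1`) a (M) record has `n₀ ≥ 1`** on X4(M): the constant term of the
Néron-normalised multiplicative branch VANISHES (n1011-p07's
`constantCoeff_multBranch_eq_zero_of_entireLFunction_one_eq_zero`; `hPal` at `p ≡ 1 (mod 4)`), so it is
not a unit. [cite: MazurTateTeitelbaum1986Invent, §I.13–I.14] [cite: Pal2012, Thm. 3.2] -/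
theorem ClassX4M.one_le_multFirstUnitIndexRecord_of_entireLFunction_one_eq_zero
    (hPal : Pal2012.thm32_sqrt_mul_realPeriodRat_twist_eq_of_prime_one_mod_four)
    (hmod : hasEntireLFunction_rat) (hmodD : nonempty_modularParametrizationData)
    (hX : ClassX4M W p) (hL : W.entireLFunction 1 = 0) {n₀ : ℕ}
    (hrec : (p % 4 = 1 → CensusQ6.MultFirstUnitIndexAt W p n₀) ∧
      (p % 4 = 3 → CensusQ6.MultOddFirstUnitIndexAt W p n₀)) : 1 ≤ n₀ := by
  have hp2 : p ≠ 2 := hX.p_ne_two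
  obtain ⟨V, iV, iVm, C, hV, hC, N, iN, f, hf, ap, hap, ϖ, hϖ⟩ := hX.exists_recordDatum hmodD
  by_contra h0
  obtain rfl : n₀ = 0 := by omega
  have h1 := (CensusQ6.norm_coeff_of_multFirstUnitIndexRecord hp2 hrec V C hV hC f hf ap
    hap ϖ hϖ).2
  have hz := constantCoeff_multBranch_eq_zero_of_entireLFunction_one_eq_zero hPal hmod hp2
    hX.classX4.2.1 hL V C hV hC hf hap ϖ hϖ
  rw [PowerSeries.coeff_zero_eq_constantCoeff_apply, hz, norm_zero] at h1
  exact zero_ne_one h1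

/-- **`v1 = 0 ⇔ n0 = 1` at analytic rank `1` on X4(M)**: a (M) record at `n₀`, the valuation record
`MultCoeffValAt W p 1 0` and `L(E,1) = 0` force `n₀ = 1`. [cite: MazurTateTeitelbaum1986Invent, §I.13–I.14]
[cite: Pal2012, Thm. 3.2] -/
theorem ClassX4M.multFirstUnitIndexRecord_eq_one_of_multCoeffValAt_one_zero
    (hPal : Pal2012.thm32_sqrt_mul_realPeriodRat_twist_eq_of_prime_one_mod_four)
    (hmod : hasEntireLFunction_rat) (hmodD : nonempty_modularParametrizationData)
    (hX : ClassX4M W p) (hL : W.entireLFunction 1 = 0) {n₀ : ℕ}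
    (hrec : (p % 4 = 1 → CensusQ6.MultFirstUnitIndexAt W p n₀) ∧
      (p % 4 = 3 → CensusQ6.MultOddFirstUnitIndexAt W p n₀))
    (hv1 : CensusQ6.MultCoeffValAt W p 1 0) : n₀ = 1 := by
  have h1 := hX.one_le_multFirstUnitIndexRecord_of_entireLFunction_one_eq_zero hPal hmod hmodD hL hrec
  by_contra hne
  have h2 := hX.one_le_of_multFirstUnitIndexRecord_of_multCoeffValAt_one hmodD (show 2 ≤ n₀ by omega) hrec hv1
  omega

end MultRankOne

end Summit.BirchSwinnertonDyer.Rank1Residual.AdditivePotMult
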